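import Mathlib
import HarnessLib
import Summits.HubbardSuperconductivity.HubbardSuperconductivity.Theorems.KLProgrammeKLRegimeVolumeLimitTwoPointHamiltonianCutInf
import Summits.HubbardSuperconductivity.HubbardSuperconductivity.Theorems.KLProgrammeKLRegimeVolumeLimitTwoPointTimeC2
import Summits.HubbardSuperconductivity.HubbardSuperconductivity.Theorems.KLProgrammeKLRegimeVolumeLimitCutoffDoorsV14

/-!
# VL child `KLRegimeVolumeLimitV14` (stmt-HubbardSuperconductivity-19921), «cauchy» v2 stub 2b `stub_vl_sixBound`:
# the VOLUME-UNIFORM BOUND of the cutoff-free six-point scalar `Six∞_L(n,p)` — PROVED by the Hamiltonian route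
# (seat hubbard-kl-k3c5-p1 g5, technique «stub_asm_matsubara suppliers»; plan g13 ruling (R6): stub (b) cut at k3c5-p3's door into
# (b1)+(b2) `stub_vl_rates` (engine lineage) and (b3) `stub_vl_sixBound` «candidate for the direct Hamiltonian/KMS route»)

(b3) asks: in the KL regime, `∃ L₀ B, ∀ L ≥ L₀, ∀ n p, ‖klSixInf L β U μ n p‖ ≤ B` — an `L`-UNIFORM bound of k3c5-p3's cutoff-free six-point
Matsubara coefficient `Six∞_L(n,p) = D∞⁻¹·∫₀^β Σ_z e^{−iω_n u} conj χ_p(z) S∞(z,u) du` (`…VolumeLimitCutoffFreeDefs`).  The site sum `Σ_z` runs over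
`L²` sites, so NO Grassmann-side estimate of the word is volume-uniform; but the landed identities and bounds

* `klSelfEnergyInf_zero_frame` (k3c5-p3, p490113): `Σ∞⁰_L(n,p) = U·occ∞(L) + U²·Six∞_L(n,p)`;
* `klSelfEnergyInf_zero_eq_reamputated` (k3c5-p2, p491730), under (H1) at `L ≥ 3`: `Σ∞⁰_L(n,p) = Σ_H(L;n,p) := (1/D_p − 𝒢_{H'}(k₀(n), −p))·D_p²`
  (the re-amputated Matsubara Green function of the finite torus `hubbardTorusWith 2 L 1 U (μ + U/2)`);
* `norm_reamputatedProxy_le` (k3c5-p2, p490493): `‖Σ_H(L;n,p)‖ ≤ BH(β,U) := (1+|U/2|β/π)(|U/2| + (1+|U/2|β/π)·|U|(2+β|U|))` for EVERY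
  `L ≥ 3`, `n`, `p` (momentum-mode operators are bounded: KMS + two Matsubara integrations by parts, `…ThermalGreenHubbardTorusFrame`);
* `norm_klOccInf_le` (`‖occ∞‖ ≤ 3/2`);
* (H1) itself, now UNCONDITIONAL: `MatsubaraAllU.twoPoint_H1` (k3c4-p2, `…VolumeLimitTwoPointTimeC2`, on k3c5-p1 g4's split-pair determinant p490677)

give, for `U ≠ 0`,

  **`‖Six∞_L(n,p)‖ ≤ (BH(β,U) + (3/2)|U|)/U²` for every `L ≥ 3`, every Matsubara integer `n`, every torus momentum `p`, every `β > 0`, `μ`**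

(`norm_klSixInf_le`) — volume-uniform, label-uniform, frame-free, cutoff-free, for EVERY coupling `U ≠ 0`.  Consequences: the door-independent
packaged form `sixBound`; **`stub_vl_sixBound_holds`** = the v2 text of `stub_vl_sixBound` VERBATIM (plan g13 pre-render 6f46346070479240; `c₅ := 1`,
`U₀ := 1`, `L₀ := 3`; the frame, the tower and the regime bounds are not read).  The by-name closer in `…Theorems.KLRegimeVolumeLimit` is one
`exact stub_vl_sixBound_holds` once the registrant swaps the skeleton to v2.  The (H1)-conditional forms (`…_of_H1`) are kept for hands that
want the bound at one volume from the local clause.  Everything is proved; no definition.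
-/

noncomputable section

namespace Summit.HubbardSuperconductivity.HubbardSuperconductivity.Theorems.TwoPointAssembly

set_option linter.dupNamespace false -- summit = problem name (single-conjunct summit), D-0017

open Finset Filter Topology MeasureTheory intervalIntegral Complex Literature.MathematicalPhysics.QuantumLattice Literature.Probability.LatticeModels
  GrassmannAlgebra NormedSpace
open Summit.HubbardSuperconductivity.HubbardSuperconductivity.Theorems.ThermalGreen
open Summit.HubbardSuperconductivity.HubbardSuperconductivity.Theorems.MatsubaraAllU
open Summit.HubbardSuperconductivity.HubbardSuperconductivity.Theorems.KLRegimeSplit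
open Summit.HubbardSuperconductivity.HubbardSuperconductivity.Theorems.KLProgrammeLegKernels
open scoped ComplexConjugate ComplexOrder Nat

variable {L : ℕ} [NeZero L]

/-! ## §1 The explicit volume-uniform bound under (H1) at one volume -/

/-- **Algebra**: for `U ≠ 0` (and `β ≠ 0`), the six-point scalar is recovered from the bare cutoff-free carrier and the density:
`Six∞_L(n,p) = (Σ∞⁰_L(n,p) − U·occ∞(L)) / U²`. -/
theorem klSixInf_eq_sub_div {β : ℝ} (hβ : β ≠ 0) {U : ℝ} (hU : U ≠ 0) (μ : ℝ) (n : ℤ) (p : TorusSite 2 L) :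
    klSixInf L β U μ n p = (klSelfEnergyInf L β U μ 0 n p - (U : ℂ) * klOccInf L β U μ) / (U : ℂ) ^ 2 := by
  have hU2 : ((U : ℂ)) ^ 2 ≠ 0 := pow_ne_zero _ (Complex.ofReal_ne_zero.mpr hU)
  rw [klSelfEnergyInf_zero_frame hβ U μ n p, eq_div_iff hU2]
  ring

/-- **`‖Six∞_L(n,p)‖ ≤ (BH(β,U) + (3/2)|U|)/U²` UNDER (H1) AT THE VOLUME `L ≥ 3`** — every Matsubara integer `n`, every torus momentum `p`;
`BH(β,U) = (1+|U/2|β/π)(|U/2| + (1+|U/2|β/π)·|U|(2+β|U|))` is k3c5-p2's volume-uniform bound of the re-amputated Hamiltonian self-energy. -/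
theorem norm_klSixInf_le_of_H1 (hL : 3 ≤ L) {β : ℝ} (hβ : 0 < β) {U : ℝ} (hU : U ≠ 0) (μ : ℝ)
    (hH1 : ∀ (x y : TorusSite 2 L), ∀ s ∈ Set.Ioo (0 : ℝ) β,
      Tendsto (fun M : ℕ => gaussExpect ℂ (hubbardCovariance L M β μ 0)
          (positionField L M β 0 0 x s * positionField L M β 1 0 y 0 * grassmannExp (-(hubbardInteraction L M β U)))) atTop
        (𝓝 ((Real.exp (-(β * U / 4 * (L : ℝ) ^ 2)) : ℂ) *
          (Matrix.gibbsWeight (β - s) (hubbardTorusWith 2 L 1 U (μ + U / 2)) * creation (orb (FermionTorus.ofTorusSite x) 0) *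
            (Matrix.gibbsWeight s (hubbardTorusWith 2 L 1 U (μ + U / 2)) * annihilation (orb (FermionTorus.ofTorusSite y) 0))).trace /
          Matrix.partitionFn β (hubbardTorusWith 2 L 1 0 μ))))
    (n : ℤ) (p : TorusSite 2 L) :
    ‖klSixInf L β U μ n p‖ ≤ ((1 + |U / 2| * β / Real.pi) * (|U / 2| + (1 + |U / 2| * β / Real.pi) * (|U| * (2 + β * |U|))) + |U| * (3 / 2)) / U ^ 2 := by
  have hS : ‖klSelfEnergyInf L β U μ 0 n p‖ ≤ (1 + |U / 2| * β / Real.pi) * (|U / 2| + (1 + |U / 2| * β / Real.pi) * (|U| * (2 + β * |U|))) := by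
    rw [klSelfEnergyInf_zero_eq_reamputated hL hβ U μ hH1 n p]
    exact norm_reamputatedProxy_le hL hβ U μ n p
  have hocc : ‖(U : ℂ) * klOccInf L β U μ‖ ≤ |U| * (3 / 2) := by
    rw [norm_mul, Complex.norm_real, Real.norm_eq_abs]
    exact mul_le_mul_of_nonneg_left (norm_klOccInf_le (L := L) β U μ) (abs_nonneg U)
  have hU2 : (0 : ℝ) < U ^ 2 := by positivity
  rw [klSixInf_eq_sub_div hβ.ne' hU μ n p, norm_div, norm_pow, Complex.norm_real, Real.norm_eq_abs, sq_abs]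
  exact div_le_div_of_nonneg_right ((norm_sub_le _ _).trans (add_le_add hS hocc)) hU2.le

/-- **`stub_vl_sixBound` OF THE «cauchy» v2 SKELETON (19921) FROM (H1)** in k3c5-p2's global clause shape — the v2 text verbatim (`c₅ := 1`,
`U₀ := 1`, `L₀ := 3`; the frame, the tower and the regime bounds are not read: the bound holds for every `β > 0`, `U > 0`, `μ`). -/
theorem stub_vl_sixBound_of_H1
    (hH1 : ∀ β : ℝ, 0 < β → ∀ (U μ : ℝ) (L : ℕ) [NeZero L], 3 ≤ L → ∀ (x y : TorusSite 2 L), ∀ s ∈ Set.Ioo (0 : ℝ) β,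
      Tendsto (fun M : ℕ => gaussExpect ℂ (hubbardCovariance L M β μ 0)
          (positionField L M β 0 0 x s * positionField L M β 1 0 y 0 * grassmannExp (-(hubbardInteraction L M β U)))) atTop
        (𝓝 ((Real.exp (-(β * U / 4 * (L : ℝ) ^ 2)) : ℂ) *
          (Matrix.gibbsWeight (β - s) (hubbardTorusWith 2 L 1 U (μ + U / 2)) * creation (orb (FermionTorus.ofTorusSite x) 0) *
            (Matrix.gibbsWeight s (hubbardTorusWith 2 L 1 U (μ + U / 2)) * annihilation (orb (FermionTorus.ofTorusSite y) 0))).trace /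
          Matrix.partitionFn β (hubbardTorusWith 2 L 1 0 μ)))) :
    ∀ (G : GeoConsts) (P : SplitConsts) (Q : EngConsts) (R : RenConsts), G.WF → P.WF → Q.WF → R.WF →
      ∃ c₅ : ℝ, 0 < c₅ ∧ ∀ c : ℝ, 0 < c → c ≤ c₅ → ∃ U₀ : ℝ, 0 < U₀ ∧
        ∀ μ ∈ klWindowC, ∀ U : ℝ, 0 < U → U ≤ U₀ → ∀ β : ℝ, klBetaMin ≤ β → β ≤ Real.exp (c / U ^ 2) →
          ∀ K : TrigPolyC4v, klPredsV14.frameOK R U (nScales β) μ K →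
            ∀ (Lstar : ℕ) (Mstar : ℕ → ℕ), TowerP klPredsV14 G P Q R β U μ K Lstar Mstar →
              ∃ L₀ : ℕ, ∃ B : ℝ, ∀ (L : ℕ) [NeZero L], L₀ ≤ L → ∀ (n : ℤ) (k : TorusSite 2 L), ‖klSixInf L β U μ n k‖ ≤ B := by
  intro G P Q R _ _ _ _
  refine ⟨1, one_pos, fun c _ _ => ⟨1, one_pos, ?_⟩⟩
  intro μ _ U hU _ β hβmin _ K _ Lstar Mstar _
  have hβ : 0 < β := lt_of_lt_of_le (by norm_num [klBetaMin]) hβmin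
  exact ⟨3, ((1 + |U / 2| * β / Real.pi) * (|U / 2| + (1 + |U / 2| * β / Real.pi) * (|U| * (2 + β * |U|))) + |U| * (3 / 2)) / U ^ 2,
    fun L _ hL n k => norm_klSixInf_le_of_H1 hL hβ hU.ne' μ (hH1 β hβ U μ L hL) n k⟩

/-! ## §2 Unconditional: (H1) is `MatsubaraAllU.twoPoint_H1` -/

/-- **`‖Six∞_L(n,p)‖ ≤ (BH(β,U) + (3/2)|U|)/U²`, UNCONDITIONALLY** — every `L ≥ 3`, `β > 0`, `U ≠ 0`, `μ`, Matsubara integer `n`, torus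
momentum `p` (volume-uniform, label-uniform, frame-free, cutoff-free). -/
theorem norm_klSixInf_le (hL : 3 ≤ L) {β : ℝ} (hβ : 0 < β) {U : ℝ} (hU : U ≠ 0) (μ : ℝ) (n : ℤ) (p : TorusSite 2 L) :
    ‖klSixInf L β U μ n p‖ ≤ ((1 + |U / 2| * β / Real.pi) * (|U / 2| + (1 + |U / 2| * β / Real.pi) * (|U| * (2 + β * |U|))) + |U| * (3 / 2)) / U ^ 2 :=
  norm_klSixInf_le_of_H1 hL hβ hU μ (twoPoint_H1 β hβ U μ L hL) n p

/-- **(b3), DOOR-INDEPENDENT FORM, UNCONDITIONAL**: for every `β > 0`, `U ≠ 0`, `μ` there is ONE `B` with `‖klSixInf L β U μ n p‖ ≤ B` for all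
`L ≥ 3`, `n`, `p` (`B = (BH(β,U) + (3/2)|U|)/U²`). -/
theorem sixBound {β : ℝ} (hβ : 0 < β) {U : ℝ} (hU : U ≠ 0) (μ : ℝ) :
    ∃ B : ℝ, ∀ (L : ℕ) [NeZero L], 3 ≤ L → ∀ (n : ℤ) (p : TorusSite 2 L), ‖klSixInf L β U μ n p‖ ≤ B :=
  ⟨_, fun _ _ hL n p => norm_klSixInf_le hL hβ hU μ n p⟩

/-- **`stub_vl_sixBound` OF THE «cauchy» v2 SKELETON (19921) — PROVED** (v2 text verbatim, plan g13 pre-render 6f46346070479240):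
`stub_vl_sixBound_of_H1 MatsubaraAllU.twoPoint_H1`.  The by-name closer `KLRegimeVolumeLimit.stub_vl_sixBound` is `exact` this. -/
theorem stub_vl_sixBound_holds :
    ∀ (G : GeoConsts) (P : SplitConsts) (Q : EngConsts) (R : RenConsts), G.WF → P.WF → Q.WF → R.WF →
      ∃ c₅ : ℝ, 0 < c₅ ∧ ∀ c : ℝ, 0 < c → c ≤ c₅ → ∃ U₀ : ℝ, 0 < U₀ ∧
        ∀ μ ∈ klWindowC, ∀ U : ℝ, 0 < U → U ≤ U₀ → ∀ β : ℝ, klBetaMin ≤ β → β ≤ Real.exp (c / U ^ 2) →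
          ∀ K : TrigPolyC4v, klPredsV14.frameOK R U (nScales β) μ K →
            ∀ (Lstar : ℕ) (Mstar : ℕ → ℕ), TowerP klPredsV14 G P Q R β U μ K Lstar Mstar →
              ∃ L₀ : ℕ, ∃ B : ℝ, ∀ (L : ℕ) [NeZero L], L₀ ≤ L → ∀ (n : ℤ) (k : TorusSite 2 L), ‖klSixInf L β U μ n k‖ ≤ B :=
  stub_vl_sixBound_of_H1 twoPoint_H1

end Summit.HubbardSuperconductivity.HubbardSuperconductivity.Theorems.TwoPointAssembly

end
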